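import Summits.ABC.IUTFork.Joshi.ATS1PerfectoidPreliminaries
import HarnessLib

/-!
# [J-I] v4 §3 — Question 3.18.1 and Rmk. 3.16.2 RESTRICTED TO THE UNTILTS OF ONE TILT `F` (follow-up to the typer-side
# read of p432511: E-t45 FLAG-1/FLAG-2, 2026-08-26 09:16Z)

Proof/defs-light companion of `ATS1PerfectoidPreliminaries.lean` (abc-iut cell, branch E, seat abc-iut-E-t24, slot T-45;
rung LADDER-ABC:A2.E). Source: K. Joshi, arXiv 2106.11452 **v4** (bib `Joshi2021ATS1`, unrefereed, typed AS A CANDIDATE);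
render `HOME/plan/repair/lit/renders/Joshi-ATS1-2106.11452v4-PDFpaged-book-anonnd/`. TYPED ≠ PROVED ≠ ENDORSED; no side taken.

WHY. The landed readings `ATS1.Question3181 X` (Question 3.18.1, p.17 l.6–11) and `ATS1.ExistsUncountablyManyNonTopIso p`
(Rmk. 3.16.2, p.16 l.5–7) quantify over E-t1's `Untilt p` of EVERY cardinality (no tilt is recorded), exactly as the printed
sentences do («Let `K` be a complete, algebraically closed valued field containing an isometric embedding of `E`»). Read that
literally, untilts of different cardinalities are never topologically isomorphic, so Question 3.18.1 has a negative answer and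
Rmk. 3.16.2 a positive one FOR SET-THEORETIC REASONS unrelated to §3 (E-t45's FLAG-1/FLAG-2, LOW: reading strength, no kernel
defect). The CONTENTFUL reading restricts `K` to the untilts of the FIXED `F` of §3.4–§3.6 (all of cardinality `2^ℵ₀`), i.e. to
the residue fields `K_y` of ONE signature `UntiltPoints p 𝒪E` of E-t1 (p429850) — which is how Rmk. 3.16.3 was already typed
(`UntiltPoints.ExistsUncountablyManyNonIsomorphic`). This file adds the restricted reading of the Question and records, in
kernel, that it is WEAKER than the landed one (`question3181OfTilt_of_question3181`), so the flagged literal reading is the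
stronger-than-intended side and nothing downstream need consume it. Nothing is asserted; no landed declaration is edited.
[claim: Joshi2021ATS1, status: disputed]
-/

noncomputable section

namespace Summit.ABC.IUTFork.Joshi.ATS1

open Literature.AnabelianGeometry.SemiGraphs (TemperedCurve)

variable {p : ℕ} [Fact p.Prime] {𝒪E : Type} [CommRing 𝒪E]

/-- The `E`-untilt attached to a degree-one point `y` of the Fargues–Fontaine curve in E-t1's signature `UntiltPoints`
(§3.6 p.10 l.11–14: «for a given pair `(F, E)`, such fields `K ↩ E` exist and are parametrized by Fargues–Fontaine curves»):
the residue field `K_y` with `E = X.K ⊆ K̄ → K_y` through the point's preferred algebraic closure `D.algCl y` (continuous on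
`ℚ_p` by `D.continuous_algCl`). [claim: Joshi2021ATS1, status: disputed] -/
def EUntilt.ofPoint (X : TemperedCurve p) (D : UntiltPoints p 𝒪E) (y : D.Pt) : EUntilt X where
  U := D.untilt y
  ι := (D.algCl y).comp X.K.val.toRingHom
  continuous_ι := by
    refine (D.continuous_algCl y).congr fun x => ?_
    show D.algCl y (algebraMap ℚ_[p] _ x) = D.algCl y (X.K.val (algebraMap ℚ_[p] X.K x))
    rw [AlgHom.commutes]

/-- The untilt of `EUntilt.ofPoint` is the residue field `K_y`. [folklore] -/
theorem EUntilt.ofPoint_U (X : TemperedCurve p) (D : UntiltPoints p 𝒪E) (y : D.Pt) :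
    (EUntilt.ofPoint X D y).U = D.untilt y := rfl

/-- **Question 3.18.1 restricted to the untilts of the fixed `F`** (p.17 l.6–11, read with §3.4–§3.6 «all untilts `K` will be
assumed to be of this type»): is there an assignment `y ↦ Π^•_X(K_y)` of decreasing filtrations of `Π_X = Π^temp_{X/E}` by
normal subgroups, indexed by `ℝ`, on the degree-one points `y` of `𝒴_{F,E}` (E-t1's `UntiltPoints`), such that equal
filtrations force the residue fields `K_y ⊇ E` to be topologically isomorphic over `E`? A QUESTION, typed under this reading,
NOT asserted — the contentful form of the landed `Question3181` (E-t45 FLAG-1). [claim: Joshi2021ATS1, status: disputed] -/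
def Question3181OfTilt (X : TemperedCurve p) (D : UntiltPoints p 𝒪E) : Prop :=
  ∃ Φ : D.Pt → ℝ → Subgroup X.PiTemp,
    (∀ y v, (Φ y v).Normal) ∧ (∀ y, Antitone (Φ y)) ∧
      ∀ y₁ y₂ : D.Pt, Φ y₁ = Φ y₂ →
        ∃ e : (D.untilt y₁).TopEquiv (D.untilt y₂),
          ∀ x, e.toRingEquiv ((EUntilt.ofPoint X D y₁).ι x) = (EUntilt.ofPoint X D y₂).ι x

/-- The landed (unrestricted) reading implies the restricted one: restrict the assignment along `y ↦ EUntilt.ofPoint X D y`.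
So `Question3181` is the STRONGER statement (E-t45 FLAG-1: likely refutable by cardinality alone), `Question3181OfTilt` the
contentful one. PROVED. [folklore] -/
theorem question3181OfTilt_of_question3181 (X : TemperedCurve p) (D : UntiltPoints p 𝒪E) (h : Question3181 X) :
    Question3181OfTilt X D := by
  obtain ⟨Φ, hN, hA, hdet⟩ := h
  refine ⟨fun y => Φ (EUntilt.ofPoint X D y), fun y v => hN _ v, fun y => hA _, fun y₁ y₂ hy => ?_⟩
  exact hdet (EUntilt.ofPoint X D y₁) (EUntilt.ofPoint X D y₂) hy

/-- **Rmk. 3.16.2 restricted to one tilt** IS the landed Rmk. 3.16.3 reading `UntiltPoints.ExistsUncountablyManyNonIsomorphic`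
(p.16 l.8–12); over E-t1's unrestricted `Untilt p` the landed `ExistsUncountablyManyNonTopIso p` is implied by it for the
residue untilts (the image of an uncountable pairwise-non-homeomorphic set of points is an uncountable pairwise-non-homeomorphic
set of untilts). PROVED (E-t45 FLAG-2: the unrestricted form is the weaker one). [folklore] -/
theorem existsUncountablyManyNonTopIso_of_points (D : UntiltPoints p 𝒪E) (h : D.ExistsUncountablyManyNonIsomorphic) :
    ExistsUncountablyManyNonTopIso p := by
  obtain ⟨S, hS, hpair⟩ := h
  have hinj : Set.InjOn D.untilt S := fun y hy y' hy' hyy' => by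
    by_contra hne
    exact hpair hy hy' hne (by rw [hyy']; exact Untilt.TopIso.refl _)
  refine ⟨D.untilt '' S, fun hc => hS (Set.countable_of_injective_of_countable_image hinj hc), ?_⟩
  rintro _ ⟨y, hy, rfl⟩ _ ⟨y', hy', rfl⟩ hne
  exact hpair hy hy' fun h => hne (h ▸ rfl)

end Summit.ABC.IUTFork.Joshi.ATS1

end
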